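import Summits.CriticalPhenomena.PercolationContinuityZ3.Theses.PercNearOneGluing
import Literature.Probability.Percolation.PercolationEvents
import HarnessLib.Audit
import Summits.CriticalPhenomena.PercolationContinuityZ3.Theorems.PercNearOneGluingAdditiveGluingOneBond
import Summits.CriticalPhenomena.PercolationContinuityZ3.Theorems.PercNearOneGluingNearOneGluingPivotalityDomination
import Summits.CriticalPhenomena.PercolationContinuityZ3.Theorems.PercNearOneGluingNearOneGluingVariants2415

/-! TTRL-lite variant V2524 of stmt-CriticalPhenomena-4574

(`stub_shorteningStep` of line `kn_shortening_induction`, move `small_case+small_case`: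
`n ≤ 4` and `A.card = 3`).  The side conditions `A.card = 3`, `n ≤ 4`, `v ∉ A` force
`A = univ ∖ {v}`, so the glued partner `x ≠ v` is itself a relay: `x ∈ A`.  The claim then
follows from the already-landed two-relay case V2415 (`stub_shorteningStep_var2415`, `A.card ≤ 2`)
applied to the relay set `{a₀, x}`: under the glued measure `μ₁ = prodBernoulli (w[s(v,x) ↦ 1])`
the pair `s(v,x)` is almost surely open (`μ₁` is the image of `prodBernoulli w` under
`ω ↦ insert s(v,x) ω`, `goodStepEI_prodBernoulli_map_insert`), hence
`μ₁(⋃ a ∈ {a₀, x}, v ↔ a) = 1 ≥ μ₁(⋃ a ∈ A, v ↔ a)`, and the minimiser hypothesis restricts from `A`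
to `{a₀, x} ⊆ A`.  No new definitions, no named facts; the induction hypothesis is only passed on. -/

namespace Summit.CriticalPhenomena.PercolationContinuityZ3.Theorems

open MeasureTheory Set Literature.Probability.LatticeModels Literature.Probability.Percolation
open scoped Classical BigOperators

/-- TTRL-lite variant V2524 of `stub_shorteningStep` (stmt-CriticalPhenomena-4574, Kozma–Nitzan
shortening step, arXiv:2401.12397 Conjecture 6, against the old minimiser `a₀`): the inequality
`μ₁(⋃ a ∈ A, v ↔ a) · μ₁(a₀ ↔ b) ≤ μ₁(v ↔ b)` for the glued measure
`μ₁ = prodBernoulli (w[s(v,x) ↦ 1])` in the small case `n ≤ 4`, `A.card = 3`.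
Then `A = univ ∖ {v} ∋ x`, and the two-relay case V2415 for `{a₀, x}` together with
`μ₁(v ↔ x) = 1` gives the claim. -/
theorem stub_shorteningStep_var2524 : ∀ (n : ℕ) (w : Sym2 (Fin n) → unitInterval) (A : Finset (Fin n)) (b v x a₀ : Fin n), n ≤ 4 → A.card = 3 → v ∉ A → v ≠ x → w s(v, x) = 0 → a₀ ∈ A → (∀ a ∈ A, (prodBernoulli w).real (openConn a₀ b) ≤ (prodBernoulli w).real (openConn a b)) → (∀ w' : Sym2 (Fin n) → unitInterval, (∀ e, w e = 0 → w' e = 0) → ∀ (A' : Finset (Fin n)) (o' b' : Fin n) (t : ℝ), (∀ a ∈ A', t ≤ (prodBernoulli w').real (openConn a b')) → (prodBernoulli w').real (⋃ a ∈ A', openConn o' a) * t ≤ (prodBernoulli w').real (openConn o' b')) → (prodBernoulli (Function.update w s(v, x) 1)).real (⋃ a ∈ A, openConn v a) * (prodBernoulli (Function.update w s(v, x) 1)).real (openConn a₀ b) ≤ (prodBernoulli (Function.update w s(v, x) 1)).real (openConn v b) := by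
  intro n w A b v x a₀ hn hcard hvA hvx hw0 ha₀ hmin hIH
  -- `x ∈ A`: otherwise `insert v (insert x A)` would have `A.card + 2 = 5 > n` elements
  have hxA : x ∈ A := by
    by_contra hxA
    have h1 : (insert v (insert x A)).card ≤ Fintype.card (Fin n) := Finset.card_le_univ _
    rw [Finset.card_insert_of_notMem (by simp [hvx, hvA]), Finset.card_insert_of_notMem hxA,
      Fintype.card_fin] at h1
    omega
  have hva₀ : v ≠ a₀ := by
    rintro rfl
    exact hvA ha₀
  -- the two-relay case (variant V2415) for the relay set `{a₀, x} ⊆ A`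
  have h2 := stub_shorteningStep_var2415 n w ({a₀, x} : Finset (Fin n)) b v x a₀
    Finset.card_le_two (by simp [hva₀, hvx]) hvx hw0 (by simp) (fun a ha => by
      simp only [Finset.mem_insert, Finset.mem_singleton] at ha
      rcases ha with ha | ha
      · rw [ha]
      · rw [ha]; exact hmin x hxA) hIH
  -- under the glued measure the pair `s(v,x)` is a.s. open, so `μ₁(⋃ a ∈ {a₀,x}, v ↔ a) = 1`
  have hone : 1 ≤ (prodBernoulli (Function.update w s(v, x) 1)).real
      (⋃ a ∈ ({a₀, x} : Finset (Fin n)), openConn v a) := by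
    have hmi : Measurable fun ω : BondConfig (Fin n) => insert s(v, x) ω := by
      refine measurable_set_iff.2 fun i => ?_
      simp only [Set.mem_insert_iff]
      exact measurable_const.or (measurable_set_mem i)
    rw [← goodStepEI_prodBernoulli_map_insert w s(v, x),
      map_measureReal_apply hmi MeasurableSet.of_discrete]
    have huniv : (fun ω : BondConfig (Fin n) => insert s(v, x) ω) ⁻¹'
        (⋃ a ∈ ({a₀, x} : Finset (Fin n)), openConn v a) = Set.univ := by
      refine Set.eq_univ_of_forall fun ω => ?_
      simp only [Set.mem_preimage, Set.mem_iUnion, exists_prop]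
      exact ⟨x, by simp, pivDom_reachable_insert_of ω hvx (SimpleGraph.Reachable.refl x)⟩
    rw [huniv, probReal_univ]
  have hle1 : (prodBernoulli (Function.update w s(v, x) 1)).real (⋃ a ∈ A, openConn v a) ≤ 1 :=
    measureReal_le_one
  calc (prodBernoulli (Function.update w s(v, x) 1)).real (⋃ a ∈ A, openConn v a) *
        (prodBernoulli (Function.update w s(v, x) 1)).real (openConn a₀ b)
      ≤ 1 * (prodBernoulli (Function.update w s(v, x) 1)).real (openConn a₀ b) :=
        mul_le_mul_of_nonneg_right hle1 measureReal_nonneg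
    _ ≤ (prodBernoulli (Function.update w s(v, x) 1)).real
          (⋃ a ∈ ({a₀, x} : Finset (Fin n)), openConn v a) *
        (prodBernoulli (Function.update w s(v, x) 1)).real (openConn a₀ b) :=
        mul_le_mul_of_nonneg_right hone measureReal_nonneg
    _ ≤ (prodBernoulli (Function.update w s(v, x) 1)).real (openConn v b) := h2

end Summit.CriticalPhenomena.PercolationContinuityZ3.Theorems
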